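import Mathlib
import Summits.Parity.GeneralizedHardyLittlewood.Theorems.LiouvilleShiftedTablesPairsFromMAvgMoebiusSums
import Summits.Parity.GeneralizedHardyLittlewood.Theorems.LiouvilleShiftedTablesPairsToGHLStubSlopedEulerAux2

/-!
# Sloped ladder, Euler stub — part 4: the truncated Möbius sums `∑_{d ≤ x} μ(d) w̃(d)`, `∑ μ(d) w̃(d) log d`

Route `LiouvilleShiftedTables` (Parity / GeneralizedHardyLittlewood), crux stmt-Parity-9389
(`PairsToGHL`), line `sloped_ladder`, stub `stub_slopedEuler`.

With `μ(d) w̃(d) = (b ⋆ μ)(d)/d` (part 2) the route's abstract estimates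
`Theorems.PairsFromMAvg.abs_sum_convMoebius_div_le` / `abs_sum_convMoebius_log_div_add_le` and the
prime-number-theorem inputs of `…MoebiusInputs` give, for every weight `0 ≤ w̃ ≤ 1` and every `b`
with `∑_{n ≤ N} |b(n)|/√n ≤ S`:

* `exists_bound_sum_moebius_weight` — `|∑_{d ≤ x} μ(d) w̃(d)| ≤ C/(log x)²` (`x ≥ 2`);
* `exists_bound_sum_moebius_weight_log_add` —
  `|∑_{d ≤ x} μ(d) w̃(d) log d + ∑_n b(n)/n| ≤ C/log x` (`x ≥ 2`);
* `exists_bound_sum_moebius_weight_log` — `|∑_{d ≤ x} μ(d) w̃(d) log d| ≤ C`.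

Small `x < 64` are absorbed into the constants (`|μ w̃| ≤ 1`, `log x ≤ 63`); for `x ≥ 64` the
secondary terms `x^{-1/4}`, `x^{-1/8}`, `x^{-1/2}` are converted to powers of `log x`.

[folklore]
-/

noncomputable section

open Finset Real ArithmeticFunction Filter
open scoped ArithmeticFunction.Moebius ArithmeticFunction.zeta

namespace Summit.Parity.GeneralizedHardyLittlewood.Theorems.PairsToGHL.SlopedLadder

open Summit.Parity.GeneralizedHardyLittlewood.Theorems.PairsFromMAvg

/-! ### Elementary conversions to powers of `log x` -/

/-- `0 < log D` and `log D ≤ 63` for `2 ≤ D < 64`. [folklore] -/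
theorem log_pos_and_le {D : ℕ} (hD : 2 ≤ D) (hD' : D < 64) :
    0 < Real.log D ∧ Real.log D ≤ 63 := by
  have hD1 : (1 : ℝ) < D := by exact_mod_cast hD
  have hD0 : (0 : ℝ) < D := by linarith
  refine ⟨Real.log_pos hD1, (Real.log_le_sub_one_of_pos hD0).trans ?_⟩
  have : (D : ℝ) ≤ 63 := by exact_mod_cast (by omega : D ≤ 63)
  linarith

/-- `1 ≤ log D` for `D ≥ 64` (`e < 64`). [folklore] -/
theorem one_le_log {D : ℕ} (hD : 64 ≤ D) : 1 ≤ Real.log D := by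
  have hD0 : (0 : ℝ) < D := by exact_mod_cast (by omega : 0 < D)
  rw [Real.le_log_iff_exp_le hD0]
  have h1 := Real.exp_one_lt_d9
  have h2 : (64 : ℝ) ≤ D := by exact_mod_cast hD
  linarith

/-- `D^{-1/4} ≤ 64/(log D)²` for `D ≥ 2` (`log D ≤ 8 D^{1/8}`). [folklore] -/
theorem rpow_neg_quarter_le {D : ℕ} (hD : 2 ≤ D) :
    (D : ℝ) ^ (-(1 / 4 : ℝ)) ≤ 64 / Real.log D ^ 2 := by
  have hD1 : (1 : ℝ) < D := by exact_mod_cast hD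
  have hD0 : (0 : ℝ) < D := by linarith
  have hlog : 0 < Real.log D := Real.log_pos hD1
  have hl : Real.log D ≤ 8 * (D : ℝ) ^ (1 / 8 : ℝ) := by
    have := Real.log_le_rpow_div hD0.le (by norm_num : (0 : ℝ) < 1 / 8)
    linarith [this]
  have hy : 0 ≤ (D : ℝ) ^ (1 / 8 : ℝ) := Real.rpow_nonneg hD0.le _
  have hq : (D : ℝ) ^ (1 / 4 : ℝ) = ((D : ℝ) ^ (1 / 8 : ℝ)) ^ 2 := by
    rw [← Real.rpow_natCast, ← Real.rpow_mul hD0.le]; norm_num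
  rw [Real.rpow_neg hD0.le, ← one_div, div_le_div_iff₀ (Real.rpow_pos_of_pos hD0 _) (pow_pos hlog 2),
    one_mul, hq]
  nlinarith [pow_le_pow_left₀ hlog.le hl 2]

/-- `D^{-1/8} ≤ 8/log D` for `D ≥ 2`. [folklore] -/
theorem rpow_neg_eighth_le {D : ℕ} (hD : 2 ≤ D) :
    (D : ℝ) ^ (-(1 / 8 : ℝ)) ≤ 8 / Real.log D := by
  have hD1 : (1 : ℝ) < D := by exact_mod_cast hD
  have hD0 : (0 : ℝ) < D := by linarith
  have hlog : 0 < Real.log D := Real.log_pos hD1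
  have hl : Real.log D ≤ 8 * (D : ℝ) ^ (1 / 8 : ℝ) := by
    have := Real.log_le_rpow_div hD0.le (by norm_num : (0 : ℝ) < 1 / 8)
    linarith [this]
  rw [Real.rpow_neg hD0.le, ← one_div, div_le_div_iff₀ (Real.rpow_pos_of_pos hD0 _) hlog, one_mul]
  linarith

/-- `1/√D ≤ 2/log D` for `D ≥ 2` (`log D ≤ 2√D`). [folklore] -/
theorem one_div_sqrt_le {D : ℕ} (hD : 2 ≤ D) : 1 / Real.sqrt D ≤ 2 / Real.log D := by
  have hD1 : (1 : ℝ) < D := by exact_mod_cast hD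
  have hD0 : (0 : ℝ) < D := by linarith
  have hlog : 0 < Real.log D := Real.log_pos hD1
  have hl : Real.log D ≤ 2 * Real.sqrt D := by
    have := Real.log_le_rpow_div hD0.le (by norm_num : (0 : ℝ) < 1 / 2)
    rw [← Real.sqrt_eq_rpow] at this
    linarith [this]
  rw [div_le_div_iff₀ (Real.sqrt_pos.mpr hD0) hlog, one_mul]
  linarith

/-! ### Trivial bounds for small `x` -/

/-- `|∑_{d ≤ D} μ(d) w̃(d)| ≤ D` for `0 ≤ w̃ ≤ 1`. [folklore] -/
theorem abs_sum_moebius_weight_le (W : ℕ → ℝ) (hW0 : ∀ d, 0 ≤ W d) (hW1 : ∀ d, W d ≤ 1) (D : ℕ) :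
    |∑ d ∈ Icc 1 D, (μ d : ℝ) * W d| ≤ D := by
  calc |∑ d ∈ Icc 1 D, (μ d : ℝ) * W d| ≤ ∑ d ∈ Icc 1 D, |(μ d : ℝ) * W d| := abs_sum_le_sum_abs _ _
    _ ≤ ∑ d ∈ Icc 1 D, (1 : ℝ) := by
        refine Finset.sum_le_sum fun d _ => ?_
        rw [abs_mul, abs_of_nonneg (hW0 d)]
        have h1 : |(μ d : ℝ)| ≤ 1 := by exact_mod_cast abs_moebius_le_one
        exact mul_le_one₀ h1 (hW0 d) (hW1 d)
    _ = D := by simp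

/-- `|∑_{d ≤ D} μ(d) w̃(d) log d| ≤ D log D` for `0 ≤ w̃ ≤ 1`. [folklore] -/
theorem abs_sum_moebius_weight_log_le (W : ℕ → ℝ) (hW0 : ∀ d, 0 ≤ W d) (hW1 : ∀ d, W d ≤ 1)
    (D : ℕ) : |∑ d ∈ Icc 1 D, (μ d : ℝ) * W d * Real.log d| ≤ D * Real.log D := by
  calc |∑ d ∈ Icc 1 D, (μ d : ℝ) * W d * Real.log d|
      ≤ ∑ d ∈ Icc 1 D, |(μ d : ℝ) * W d * Real.log d| := abs_sum_le_sum_abs _ _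
    _ ≤ ∑ d ∈ Icc 1 D, Real.log D := by
        refine Finset.sum_le_sum fun d hd => ?_
        obtain ⟨hd1, hdD⟩ := Finset.mem_Icc.mp hd
        have hlogd : 0 ≤ Real.log d := Real.log_nonneg (by exact_mod_cast hd1)
        have hlogdD : Real.log d ≤ Real.log D :=
          Real.log_le_log (by exact_mod_cast hd1) (by exact_mod_cast hdD)
        rw [abs_mul, abs_mul, abs_of_nonneg (hW0 d), abs_of_nonneg hlogd]
        have h1 : |(μ d : ℝ)| ≤ 1 := by exact_mod_cast abs_moebius_le_one
        calc |(μ d : ℝ)| * W d * Real.log d ≤ 1 * Real.log d := by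
              refine mul_le_mul_of_nonneg_right (mul_le_one₀ h1 (hW0 d) (hW1 d)) hlogd
          _ ≤ Real.log D := by rw [one_mul]; exact hlogdD
    _ = D * Real.log D := by simp

/-! ### The estimates -/

/-- **`∑_{d ≤ x} μ(d) w̃(d) ≪ (log x)⁻²`.** For `0 ≤ w̃ ≤ 1` with `μ(d) d w̃(d) = (b ⋆ μ)(d)` and
`∑_{n ≤ N} |b(n)|/√n ≤ S`: `|∑_{d ≤ x} μ(d) w̃(d)| ≤ C/(log x)²` for all `x ≥ 2`. [folklore] -/
theorem exists_bound_sum_moebius_weight (W : ℕ → ℝ) (hW0 : ∀ d, 0 ≤ W d) (hW1 : ∀ d, W d ≤ 1)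
    (b : ArithmeticFunction ℝ)
    (hbμ : ∀ d : ℕ, (b * (μ : ArithmeticFunction ℝ)) d = (μ d : ℝ) * d * W d)
    {S : ℝ} (hS : ∀ N, ∑ n ∈ Icc 1 N, |b n| / Real.sqrt n ≤ S) :
    ∃ C : ℝ, ∀ D : ℕ, 2 ≤ D → |∑ d ∈ Icc 1 D, (μ d : ℝ) * W d| ≤ C / Real.log D ^ 2 := by
  obtain ⟨K, hK0, hK⟩ := exists_abs_sum_moebius_div_le
  obtain ⟨Cm, hCm0, hCm⟩ := exists_abs_sum_moebius_div_le_div_log_sq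
  have hS0 : 0 ≤ S := le_trans (by simp) (hS 0)
  refine ⟨S * (9 * Cm + 64 * K) + 63 ^ 3, fun D hD => ?_⟩
  have hD1 : (1 : ℝ) < D := by exact_mod_cast hD
  have hlog : 0 < Real.log D := Real.log_pos hD1
  have hre : ∑ d ∈ Icc 1 D, (μ d : ℝ) * W d =
      ∑ d ∈ Icc 1 D, (b * (μ : ArithmeticFunction ℝ)) d / d := by
    refine Finset.sum_congr rfl fun d hd => ?_
    have hd1 := (Finset.mem_Icc.mp hd).1
    have hd0 : (d : ℝ) ≠ 0 := by exact_mod_cast (by omega : d ≠ 0)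
    rw [hbμ]
    field_simp
  have hC0 : 0 ≤ S * (9 * Cm + 64 * K) := by positivity
  rcases lt_or_ge D 64 with hD64 | hD64
  · have hA := abs_sum_moebius_weight_le W hW0 hW1 D
    have hD63 : (D : ℝ) ≤ 63 := by exact_mod_cast (by omega : D ≤ 63)
    have hl63 := (log_pos_and_le hD hD64).2
    rw [le_div_iff₀ (pow_pos hlog 2)]
    have hl2 : Real.log D ^ 2 ≤ 63 ^ 2 := pow_le_pow_left₀ hlog.le hl63 2
    nlinarith [abs_nonneg (∑ d ∈ Icc 1 D, (μ d : ℝ) * W d)]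
  · have h := abs_sum_convMoebius_div_le b hS hK hCm0 hCm hD64
    rw [← hre] at h
    have hpow := rpow_neg_quarter_le hD
    calc |∑ d ∈ Icc 1 D, (μ d : ℝ) * W d|
        ≤ S * (9 * Cm / Real.log D ^ 2) + S * (K * (D : ℝ) ^ (-(1 / 4 : ℝ))) := h
      _ ≤ S * (9 * Cm / Real.log D ^ 2) + S * (K * (64 / Real.log D ^ 2)) := by gcongr
      _ = S * (9 * Cm + 64 * K) / Real.log D ^ 2 := by ring
      _ ≤ (S * (9 * Cm + 64 * K) + 63 ^ 3) / Real.log D ^ 2 :=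
          div_le_div_of_nonneg_right (by linarith) (pow_pos hlog 2).le

/-- **`∑_{d ≤ x} μ(d) w̃(d) log d + ∑_n b(n)/n ≪ (log x)⁻¹`.** For `0 ≤ w̃ ≤ 1` with
`μ(d) d w̃(d) = (b ⋆ μ)(d)` and `∑_{n ≤ N} |b(n)|/√n ≤ S`:
`|∑_{d ≤ x} μ(d) w̃(d) log d + ∑_n b(n)/n| ≤ C/log x` for all `x ≥ 2` (the tree's
`abs_sum_convMoebius_log_div_add_le` plus the tail `|∑_{n ≤ x} b(n)/n - ∑_n b(n)/n| ≤ S/√x`).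
[folklore] -/
theorem exists_bound_sum_moebius_weight_log_add (W : ℕ → ℝ) (hW0 : ∀ d, 0 ≤ W d)
    (hW1 : ∀ d, W d ≤ 1) (b : ArithmeticFunction ℝ)
    (hbμ : ∀ d : ℕ, (b * (μ : ArithmeticFunction ℝ)) d = (μ d : ℝ) * d * W d)
    {S : ℝ} (hS : ∀ N, ∑ n ∈ Icc 1 N, |b n| / Real.sqrt n ≤ S) :
    ∃ C : ℝ, ∀ D : ℕ, 2 ≤ D →
      |∑ d ∈ Icc 1 D, (μ d : ℝ) * W d * Real.log d + ∑' n : ℕ, b n / n| ≤ C / Real.log D := by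
  obtain ⟨K, hK0, hK⟩ := exists_abs_sum_moebius_div_le
  obtain ⟨K₁, hK₁0, hK₁⟩ := exists_abs_sum_moebius_log_div_add_one_le
  obtain ⟨Cm, hCm0, hCm⟩ := exists_abs_sum_moebius_div_le_div_log_sq
  obtain ⟨C₁, hC₁0, hC₁⟩ := exists_abs_sum_moebius_log_div_add_one_le_div_log_sq
  have hS0 : 0 ≤ S := le_trans (by simp) (hS 0)
  have hH₀ : |∑' n : ℕ, b n / n| ≤ S := abs_tsum_div_le b hS
  refine ⟨S * (27 * (Cm + C₁)) + S * (5 * (K + K₁)) * 8 + 2 * S + (63 ^ 2 + S) * 63,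
    fun D hD => ?_⟩
  have hD1 : (1 : ℝ) < D := by exact_mod_cast hD
  have hD0 : (0 : ℝ) < D := by linarith
  have hlog : 0 < Real.log D := Real.log_pos hD1
  have hre : ∑ d ∈ Icc 1 D, (μ d : ℝ) * W d * Real.log d =
      ∑ d ∈ Icc 1 D, (b * (μ : ArithmeticFunction ℝ)) d * Real.log d / d := by
    refine Finset.sum_congr rfl fun d hd => ?_
    have hd1 := (Finset.mem_Icc.mp hd).1
    have hd0 : (d : ℝ) ≠ 0 := by exact_mod_cast (by omega : d ≠ 0)
    rw [hbμ]
    field_simp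
  have hE0 : 0 ≤ S * (27 * (Cm + C₁)) + S * (5 * (K + K₁)) * 8 + 2 * S := by positivity
  rcases lt_or_ge D 64 with hD64 | hD64
  · -- small `D`: `|A₁| ≤ 63²`, `|H₀| ≤ S`, `log D ≤ 63`
    have hA := abs_sum_moebius_weight_log_le W hW0 hW1 D
    have hD63 : (D : ℝ) ≤ 63 := by exact_mod_cast (by omega : D ≤ 63)
    have hl63 := (log_pos_and_le hD hD64).2
    have hA' : |∑ d ∈ Icc 1 D, (μ d : ℝ) * W d * Real.log d| ≤ 63 ^ 2 := by
      calc |∑ d ∈ Icc 1 D, (μ d : ℝ) * W d * Real.log d| ≤ D * Real.log D := hA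
        _ ≤ 63 * 63 := mul_le_mul hD63 hl63 hlog.le (by norm_num)
        _ = 63 ^ 2 := by norm_num
    have hsum : |∑ d ∈ Icc 1 D, (μ d : ℝ) * W d * Real.log d + ∑' n : ℕ, b n / n| ≤ 63 ^ 2 + S :=
      (abs_add_le _ _).trans (add_le_add hA' hH₀)
    rw [le_div_iff₀ hlog]
    nlinarith [abs_nonneg (∑ d ∈ Icc 1 D, (μ d : ℝ) * W d * Real.log d + ∑' n : ℕ, b n / n)]
  · -- large `D`
    have h := abs_sum_convMoebius_log_div_add_le b hS hK hK₁ hCm0 hCm hC₁0 hC₁ hD64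
    rw [← hre] at h
    have htail := abs_sum_div_sub_tsum_le b hS (D := D) (by omega)
    have h1 := one_le_log hD64
    have h8 := rpow_neg_eighth_le hD
    have h2 := one_div_sqrt_le hD
    have hP : |∑ d ∈ Icc 1 D, (μ d : ℝ) * W d * Real.log d + ∑' n : ℕ, b n / n| ≤
        (S * (27 * (Cm + C₁) / Real.log D ^ 2) + S * (5 * (K + K₁) * (D : ℝ) ^ (-(1 / 8 : ℝ)))) +
          S / Real.sqrt D := by
      have e : ∑ d ∈ Icc 1 D, (μ d : ℝ) * W d * Real.log d + ∑' n : ℕ, b n / n =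
          (∑ d ∈ Icc 1 D, (μ d : ℝ) * W d * Real.log d + ∑ n ∈ Icc 1 D, b n / n) +
            (∑' n : ℕ, b n / n - ∑ n ∈ Icc 1 D, b n / n) := by ring
      rw [e]
      refine (abs_add_le _ _).trans (add_le_add h ?_)
      rwa [abs_sub_comm] at htail
    calc |∑ d ∈ Icc 1 D, (μ d : ℝ) * W d * Real.log d + ∑' n : ℕ, b n / n|
        ≤ (S * (27 * (Cm + C₁) / Real.log D ^ 2) + S * (5 * (K + K₁) * (D : ℝ) ^ (-(1 / 8 : ℝ)))) +
            S / Real.sqrt D := hP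
      _ ≤ (S * (27 * (Cm + C₁) / Real.log D) + S * (5 * (K + K₁) * (8 / Real.log D))) +
            S * (2 / Real.log D) := by
          refine add_le_add (add_le_add ?_ ?_) ?_
          · refine mul_le_mul_of_nonneg_left ?_ hS0
            exact div_le_div_of_nonneg_left (by positivity) hlog (by nlinarith)
          · exact mul_le_mul_of_nonneg_left (mul_le_mul_of_nonneg_left h8 (by positivity)) hS0
          · rw [div_eq_mul_one_div]
            exact mul_le_mul_of_nonneg_left h2 hS0
      _ = (S * (27 * (Cm + C₁)) + S * (5 * (K + K₁)) * 8 + 2 * S) / Real.log D := by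
          field_simp
      _ ≤ (S * (27 * (Cm + C₁)) + S * (5 * (K + K₁)) * 8 + 2 * S + (63 ^ 2 + S) * 63) /
            Real.log D :=
          div_le_div_of_nonneg_right (by nlinarith) hlog.le

/-- **`∑_{d ≤ x} μ(d) w̃(d) log d` is bounded** (corollary: `|∑_n b(n)/n| ≤ S`). [folklore] -/
theorem exists_bound_sum_moebius_weight_log (W : ℕ → ℝ) (hW0 : ∀ d, 0 ≤ W d)
    (hW1 : ∀ d, W d ≤ 1) (b : ArithmeticFunction ℝ)
    (hbμ : ∀ d : ℕ, (b * (μ : ArithmeticFunction ℝ)) d = (μ d : ℝ) * d * W d)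
    {S : ℝ} (hS : ∀ N, ∑ n ∈ Icc 1 N, |b n| / Real.sqrt n ≤ S) :
    ∃ C : ℝ, ∀ D : ℕ, 2 ≤ D → |∑ d ∈ Icc 1 D, (μ d : ℝ) * W d * Real.log d| ≤ C := by
  obtain ⟨C, hC⟩ := exists_bound_sum_moebius_weight_log_add W hW0 hW1 b hbμ hS
  have hH₀ : |∑' n : ℕ, b n / n| ≤ S := abs_tsum_div_le b hS
  have hl2 : 0 < Real.log 2 := Real.log_pos one_lt_two
  have hC0 : 0 ≤ C := by
    have h2 := (abs_nonneg _).trans (hC 2 le_rfl)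
    rw [Nat.cast_ofNat] at h2
    by_contra hneg
    exact absurd h2 (not_le.mpr (div_neg_of_neg_of_pos (not_le.mp hneg) hl2))
  refine ⟨C / Real.log 2 + S, fun D hD => ?_⟩
  have hlog2 : Real.log 2 ≤ Real.log D := Real.log_le_log two_pos (by exact_mod_cast hD)
  calc |∑ d ∈ Icc 1 D, (μ d : ℝ) * W d * Real.log d|
      = |(∑ d ∈ Icc 1 D, (μ d : ℝ) * W d * Real.log d + ∑' n : ℕ, b n / n) - ∑' n : ℕ, b n / n| := by
        rw [add_sub_cancel_right]
    _ ≤ |∑ d ∈ Icc 1 D, (μ d : ℝ) * W d * Real.log d + ∑' n : ℕ, b n / n| + |∑' n : ℕ, b n / n| :=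
        abs_sub _ _
    _ ≤ C / Real.log D + S := add_le_add (hC D hD) hH₀
    _ ≤ C / Real.log 2 + S := by
        gcongr

/-! ### Registered sub-goal of this helper file -/

/-- **Part 4 of `stub_slopedEuler` (registered sub-goal `stub_slopedEuler_part4`).**
`|∑_{d ≤ x} μ(d) w̃(d) log d + ∑_n b(n)/n| ≤ C/log x` for `0 ≤ w̃ ≤ 1`, `μ · id · w̃ = b ⋆ μ`,
`∑_{n ≤ N} |b(n)|/√n ≤ S`. [folklore] -/
theorem stub_slopedEuler_part4 :
    ∀ (W : ℕ → ℝ), (∀ d, 0 ≤ W d) → (∀ d, W d ≤ 1) → ∀ (b : ArithmeticFunction ℝ), (∀ d : ℕ, (b * (ArithmeticFunction.moebius : ArithmeticFunction ℝ)) d = (ArithmeticFunction.moebius d : ℝ) * d * W d) → ∀ S : ℝ, (∀ N : ℕ, ∑ n ∈ Finset.Icc 1 N, |b n| / Real.sqrt n ≤ S) → ∃ C : ℝ, ∀ D : ℕ, 2 ≤ D → |∑ d ∈ Finset.Icc 1 D, (ArithmeticFunction.moebius d : ℝ) * W d * Real.log d + ∑' n : ℕ, b n / n| ≤ C / Real.log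 D :=
  fun W hW0 hW1 b hbμ _ hS => exists_bound_sum_moebius_weight_log_add W hW0 hW1 b hbμ hS

end Summit.Parity.GeneralizedHardyLittlewood.Theorems.PairsToGHL.SlopedLadder
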